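import Summits.KontsevichZagierPeriods.KontsevichZagierPeriods.Theses.CobordismMove
import Literature.NumberTheory.Transcendental.KZLogCalculusProofs
import Literature.NumberTheory.Transcendental.KZUnfoldedStokesProofs

/-!
# `CubeStokes` (stmt-KontsevichZagierPeriods-5566, route CobordismMove) — typed decomposition

Closed-form Stokes on the unit cube (`CubeStokes`: the signed sum of the `2(d+1)` face
representations of a closed `ℚ`-semialgebraic coefficient system `A₀, …, A_d` on `[0,1]^(d+1)` lies
in `KZ.relations`) is assembled here from THREE strictly smaller statements about the fixed calculus
of moves, each quantified inline as a hypothesis of `cubeStokes_of_subs` (they are the split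
children `CubeLastNewtonLeibniz`, `CubeCoordinateCycle`, `ZeroCombination` of the route node):

* (P1) `CubeLastNewtonLeibniz` — Newton–Leibniz along the LAST coordinate of the open unit cube,
  bulk term included: `[(0,1)^(d+1), ∂_last A] − [(0,1)^d, A(·,1)] + [(0,1)^d, A(·,0)] ∈ relations`
  for ONE coefficient `A` (an exact form; no closedness);
* (P2) `CubeCoordinateCycle` — cycling the coordinate `k` to the last slot,
  `z ↦ Fin.insertNth k (z last) (Fin.init z)`, is a move on the open unit cube for an ARBITRARY
  integrand (rule (2) with a permutation matrix);
* (P3) `ZeroCombination` — a `ℤ`-combination of representations on a common domain whose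
  integrands combine to `0` pointwise is a relation (iterated rule (1)).

The assembly is where the closedness hypothesis and the coordinate bookkeeping live: for each `k`
the coefficient `A_k` and its partial `A'_k = ∂_k A_k` are TRANSPORTED through the coordinate cycle
(semialgebraicity by relabelling coordinates, continuity, absolute integrability by the
volume-preserving relabelling `MeasurableEquiv.piCongrLeft`, and the fibrewise derivative through
`Function.update ∘ Fin.insertNth`), the bulk representations `[(0,1)^(d+1), A'_k]` and their cycled
copies are built as honest `KZ.IntegralRep`s, (P2) identifies the two, (P1) turns each cycled bulk
term into the two `k`-faces, (P3) kills `Σ_k (−1)^k [(0,1)^(d+1), A'_k]` by closedness, and the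
signs are collected in the free abelian group.

References: M. Kontsevich, D. Zagier, *Periods* (2001), §1.2 (rules (1)–(3); "replace the
Newton–Leibniz formula by Stokes's formula"); J. Bochnak, M. Coste, M.-F. Roy, *Real Algebraic
Geometry* (1998), §2.2 (semialgebraic functions under coordinate changes).
-/

noncomputable section

open MeasureTheory Set
open Literature.NumberTheory.Transcendental
open Literature.ModelTheory.ExponentialFields (IsSemialgebraic)

namespace Summit.KontsevichZagierPeriods.CobordismMove.CubeStokesSplit

open Summit.KontsevichZagierPeriods.KontsevichZagierPeriods.Theses.CobordismMove

variable {d : ℕ}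

/-! ### Coordinate cycles as index permutations -/

/-- The coordinate cycle `z ↦ Fin.insertNth k (z last) (Fin.init z)` of `ℝ^(d+1)` is the
relabelling of coordinates along an index permutation (namely
`(finSuccEquiv' k).trans (finSuccEquiv' (Fin.last d)).symm`: `k ↦ last`, `k.succAbove j ↦ j.castSucc`).
[folklore] -/
theorem exists_perm_insertNth (k : Fin (d + 1)) :
    ∃ e : Equiv.Perm (Fin (d + 1)), ∀ z : Fin (d + 1) → ℝ,
      (fun i => z (e i)) = (Fin.insertNth k (z (Fin.last d)) (Fin.init z) : Fin (d + 1) → ℝ) := by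
  refine ⟨(finSuccEquiv' k).trans (finSuccEquiv' (Fin.last d)).symm, fun z => ?_⟩
  funext i
  rcases Fin.eq_self_or_eq_succAbove k i with rfl | ⟨j, rfl⟩
  · simp [finSuccEquiv'_at, finSuccEquiv'_symm_none, Fin.insertNth_apply_same]
  · simp [finSuccEquiv'_succAbove, finSuccEquiv'_symm_some, Fin.insertNth_apply_succAbove,
      Fin.succAbove_last, Fin.init]

/-- The open unit cube is invariant under relabelling coordinates. [folklore] -/
theorem comp_perm_mem_setOf_iff {n : ℕ} (e : Equiv.Perm (Fin n)) (z : Fin n → ℝ) :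
    (fun i => z (e i)) ∈ {x : Fin n → ℝ | ∀ i, x i ∈ Ioo (0 : ℝ) 1} ↔
      z ∈ {x : Fin n → ℝ | ∀ i, x i ∈ Ioo (0 : ℝ) 1} := by
  simp only [mem_setOf_eq]
  exact ⟨fun h i => by simpa using h (e.symm i), fun h i => h (e i)⟩

/-- The closed unit cube is invariant under relabelling coordinates. [folklore] -/
theorem comp_perm_mem_Icc_iff {n : ℕ} (e : Equiv.Perm (Fin n)) (z : Fin n → ℝ) :
    (fun i => z (e i)) ∈ Icc (0 : Fin n → ℝ) 1 ↔ z ∈ Icc (0 : Fin n → ℝ) 1 := by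
  simp only [mem_Icc, Pi.le_def, Pi.zero_apply, Pi.one_apply]
  constructor
  · rintro ⟨h0, h1⟩
    exact ⟨fun i => by simpa using h0 (e.symm i), fun i => by simpa using h1 (e.symm i)⟩
  · rintro ⟨h0, h1⟩
    exact ⟨fun i => h0 (e i), fun i => h1 (e i)⟩

/-- Semialgebraicity on the open unit cube is invariant under relabelling coordinates.
[cite: BCR1998, §2.2] -/
theorem isSemialgebraicFunOn_comp_perm_setOf {n : ℕ} (e : Equiv.Perm (Fin n))
    {f : (Fin n → ℝ) → ℝ} (hf : IsSemialgebraicFunOn ℚ {x : Fin n → ℝ | ∀ i, x i ∈ Ioo (0 : ℝ) 1} f) :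
    IsSemialgebraicFunOn ℚ {x : Fin n → ℝ | ∀ i, x i ∈ Ioo (0 : ℝ) 1}
      (fun z => f (fun i => z (e i))) := by
  have h := hf.comp_equiv e
  have hset : {w : Fin n → ℝ | (fun i => w (e i)) ∈ {x : Fin n → ℝ | ∀ i, x i ∈ Ioo (0 : ℝ) 1}} =
      {x : Fin n → ℝ | ∀ i, x i ∈ Ioo (0 : ℝ) 1} := by
    ext w
    exact comp_perm_mem_setOf_iff e w
  rwa [hset] at h

/-- Semialgebraicity on the closed unit cube is invariant under relabelling coordinates.
[cite: BCR1998, §2.2] -/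
theorem isSemialgebraicFunOn_comp_perm_Icc {n : ℕ} (e : Equiv.Perm (Fin n))
    {f : (Fin n → ℝ) → ℝ} (hf : IsSemialgebraicFunOn ℚ (Icc (0 : Fin n → ℝ) 1) f) :
    IsSemialgebraicFunOn ℚ (Icc (0 : Fin n → ℝ) 1) (fun z => f (fun i => z (e i))) := by
  have h := hf.comp_equiv e
  have hset : {w : Fin n → ℝ | (fun i => w (e i)) ∈ Icc (0 : Fin n → ℝ) 1} =
      Icc (0 : Fin n → ℝ) 1 := by
    ext w
    exact comp_perm_mem_Icc_iff e w
  rwa [hset] at h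

/-- Relabelling coordinates is continuous. [folklore] -/
theorem continuous_comp_perm {n : ℕ} (e : Equiv.Perm (Fin n)) :
    Continuous (fun z : Fin n → ℝ => fun i => z (e i)) :=
  continuous_pi fun i => continuous_apply (e i)

/-- Absolute integrability on the open unit cube is invariant under relabelling coordinates: the
relabelling is the volume-preserving `MeasurableEquiv.piCongrLeft` and preserves the cube.
[folklore] -/
theorem integrableOn_comp_perm_setOf {n : ℕ} (e : Equiv.Perm (Fin n)) {f : (Fin n → ℝ) → ℝ}
    (hf : IntegrableOn f {x : Fin n → ℝ | ∀ i, x i ∈ Ioo (0 : ℝ) 1}) :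
    IntegrableOn (fun z => f (fun i => z (e i))) {x : Fin n → ℝ | ∀ i, x i ∈ Ioo (0 : ℝ) 1} := by
  set L : (Fin n → ℝ) ≃ᵐ (Fin n → ℝ) := MeasurableEquiv.piCongrLeft (fun _ : Fin n => ℝ) e.symm
    with hL_def
  have hL : MeasurePreserving L volume volume :=
    volume_measurePreserving_piCongrLeft (fun _ : Fin n => ℝ) e.symm
  have hLapply : ∀ z : Fin n → ℝ, L z = fun i => z (e i) := by
    intro z
    funext i
    have h := Equiv.piCongrLeft_apply_apply (fun _ : Fin n => ℝ) e.symm z (e i)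
    rw [hL_def, MeasurableEquiv.coe_piCongrLeft]
    simpa using h
  have hpre : L ⁻¹' {x : Fin n → ℝ | ∀ i, x i ∈ Ioo (0 : ℝ) 1} =
      {x : Fin n → ℝ | ∀ i, x i ∈ Ioo (0 : ℝ) 1} := by
    ext z
    rw [mem_preimage, hLapply]
    exact comp_perm_mem_setOf_iff e z
  have h := (hL.integrableOn_comp_preimage L.measurableEmbedding (f := f)
    (s := {x : Fin n → ℝ | ∀ i, x i ∈ Ioo (0 : ℝ) 1})).mpr hf
  rw [hpre] at h
  exact h.congr_fun (fun z _ => by simp only [Function.comp_apply, hLapply])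
    (KZ.isOpen_unitCube n).measurableSet

/-- Updating the inserted coordinate. [folklore] -/
theorem update_insertNth (k : Fin (d + 1)) (t s : ℝ) (y : Fin d → ℝ) :
    Function.update (Fin.insertNth k t y : Fin (d + 1) → ℝ) k s = Fin.insertNth k s y := by
  rw [KZ.insertNth_eq_update k t y, KZ.insertNth_eq_update k s y, Function.update_idem]

/-- Inserting a coordinate in `(0,1)` into a point of the open `d`-cube gives a point of the open
`(d+1)`-cube. [folklore] -/
theorem insertNth_mem_setOf (k : Fin (d + 1)) {t : ℝ} (ht : t ∈ Ioo (0 : ℝ) 1) {y : Fin d → ℝ}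
    (hy : y ∈ {y : Fin d → ℝ | ∀ i, y i ∈ Ioo (0 : ℝ) 1}) :
    (Fin.insertNth k t y : Fin (d + 1) → ℝ) ∈ {x : Fin (d + 1) → ℝ | ∀ i, x i ∈ Ioo (0 : ℝ) 1} := by
  simp only [mem_setOf_eq] at hy ⊢
  intro i
  rcases Fin.eq_self_or_eq_succAbove k i with rfl | ⟨j, rfl⟩
  · simpa [Fin.insertNth_apply_same] using ht
  · simpa [Fin.insertNth_apply_succAbove] using hy j

/-! ### The assembly -/

/-- **`CubeStokes` from its three pieces** (glue of the split
`CubeLastNewtonLeibniz → CubeCoordinateCycle → ZeroCombination → CubeStokes` of route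
CobordismMove; the three hypotheses are the literal bodies of the three children).
For each coordinate `k` the coefficient `A_k` and its partial `A'_k` are transported through the
coordinate cycle `z ↦ insertNth k (z last) (init z)` (semialgebraicity, continuity, integrability,
fibrewise derivative), the bulk representation `R_k = [(0,1)^(d+1), A'_k]` and its cycled copy
`R̃_k` are built; (P2) gives `[R_k] − [R̃_k] ∈ relations`, (P1) gives
`[R̃_k] − [face_k¹] + [face_k⁰] ∈ relations`, (P3) with the closedness
`Σ_k (−1)^k A'_k = 0` gives `Σ_k (−1)^k [R_k] ∈ relations`, and
`Σ_k Σ_s (−1)^(k+s) [face_kˢ] = Σ_k (−1)^k (([R̃_k] − [face_k¹] + [face_k⁰]) + ([R_k] − [R̃_k])) − Σ_k (−1)^k [R_k]`.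
[cite: KontsevichZagier2001, §1.2] -/
theorem cubeStokes_of_subs
    (h₁ : ∀ (d : ℕ) (A A' : (Fin (d + 1) → ℝ) → ℝ)
      (R : Literature.NumberTheory.Transcendental.KZ.IntegralRep (d + 1))
      (r₀ r₁ : Literature.NumberTheory.Transcendental.KZ.IntegralRep d),
      Literature.NumberTheory.Transcendental.IsSemialgebraicFunOn ℚ (Set.Icc (0 : Fin (d + 1) → ℝ) 1) A →
      ContinuousOn A (Set.Icc (0 : Fin (d + 1) → ℝ) 1) →
      (∀ y ∈ {y : Fin d → ℝ | ∀ i, y i ∈ Set.Ioo (0 : ℝ) 1}, ∀ t ∈ Set.Ioo (0 : ℝ) 1,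
        HasDerivAt (fun s : ℝ => A (Fin.snoc y s)) (A' (Fin.snoc y t)) t) →
      R.domain = {x : Fin (d + 1) → ℝ | ∀ i, x i ∈ Set.Ioo (0 : ℝ) 1} →
      Set.EqOn R.integrand A' R.domain →
      r₀.domain = {y : Fin d → ℝ | ∀ i, y i ∈ Set.Ioo (0 : ℝ) 1} →
      r₁.domain = {y : Fin d → ℝ | ∀ i, y i ∈ Set.Ioo (0 : ℝ) 1} →
      Set.EqOn r₀.integrand (fun y => A (Fin.snoc y 0)) r₀.domain →
      Set.EqOn r₁.integrand (fun y => A (Fin.snoc y 1)) r₁.domain →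
      Literature.NumberTheory.Transcendental.KZ.of R - Literature.NumberTheory.Transcendental.KZ.of r₁ +
        Literature.NumberTheory.Transcendental.KZ.of r₀ ∈ Literature.NumberTheory.Transcendental.KZ.relations)
    (h₂ : ∀ (d : ℕ) (k : Fin (d + 1)) (R R' : Literature.NumberTheory.Transcendental.KZ.IntegralRep (d + 1)),
      R.domain = {x : Fin (d + 1) → ℝ | ∀ i, x i ∈ Set.Ioo (0 : ℝ) 1} →
      R'.domain = {x : Fin (d + 1) → ℝ | ∀ i, x i ∈ Set.Ioo (0 : ℝ) 1} →
      Set.EqOn R'.integrand (fun z => R.integrand (Fin.insertNth k (z (Fin.last d)) (Fin.init z))) R'.domain →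
      Literature.NumberTheory.Transcendental.KZ.of R - Literature.NumberTheory.Transcendental.KZ.of R' ∈
        Literature.NumberTheory.Transcendental.KZ.relations)
    (h₃ : ∀ (n N : ℕ) (σ : Set (Fin n → ℝ)) (R : Fin N → Literature.NumberTheory.Transcendental.KZ.IntegralRep n)
      (c : Fin N → ℤ), (∀ i, (R i).domain = σ) → (∀ x ∈ σ, ∑ i, (c i : ℝ) * (R i).integrand x = 0) →
      (∑ i, c i • Literature.NumberTheory.Transcendental.KZ.of (R i)) ∈
        Literature.NumberTheory.Transcendental.KZ.relations) :
    CubeStokes := by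
  intro d A A' rf hA hA' hcont hder hint hclosed hdom hface
  -- index permutations realising the coordinate cycles `z ↦ insertNth k (z last) (init z)`
  choose e he using fun k : Fin (d + 1) => exists_perm_insertNth (d := d) k
  -- (a) transport of the coefficient data through the cycles
  have hBsa : ∀ k : Fin (d + 1), IsSemialgebraicFunOn ℚ (Icc (0 : Fin (d + 1) → ℝ) 1)
      (fun z => A k (Fin.insertNth k (z (Fin.last d)) (Fin.init z))) := fun k =>
    (isSemialgebraicFunOn_comp_perm_Icc (e k) (hA k)).congr fun z _ => congrArg (A k) (he k z)
  have hB'sa : ∀ k : Fin (d + 1), IsSemialgebraicFunOn ℚ {x : Fin (d + 1) → ℝ | ∀ i, x i ∈ Ioo (0 : ℝ) 1}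
      (fun z => A' k (Fin.insertNth k (z (Fin.last d)) (Fin.init z))) := fun k =>
    (isSemialgebraicFunOn_comp_perm_setOf (e k) (hA' k)).congr fun z _ => congrArg (A' k) (he k z)
  have hB'int : ∀ k : Fin (d + 1),
      IntegrableOn (fun z => A' k (Fin.insertNth k (z (Fin.last d)) (Fin.init z)))
        {x : Fin (d + 1) → ℝ | ∀ i, x i ∈ Ioo (0 : ℝ) 1} := fun k =>
    (integrableOn_comp_perm_setOf (e k) (hint k)).congr_fun (fun z _ => congrArg (A' k) (he k z))
      (KZ.isOpen_unitCube (d + 1)).measurableSet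
  have hBcont : ∀ k : Fin (d + 1),
      ContinuousOn (fun z => A k (Fin.insertNth k (z (Fin.last d)) (Fin.init z)))
        (Icc (0 : Fin (d + 1) → ℝ) 1) := by
    intro k
    have h : ContinuousOn (fun z : Fin (d + 1) → ℝ => A k (fun i => z (e k i)))
        (Icc (0 : Fin (d + 1) → ℝ) 1) :=
      (hcont k).comp (continuous_comp_perm (e k)).continuousOn fun z hz =>
        (comp_perm_mem_Icc_iff (e k) z).2 hz
    exact h.congr fun z _ => (congrArg (A k) (he k z)).symm
  have hBder : ∀ k : Fin (d + 1), ∀ y ∈ {y : Fin d → ℝ | ∀ i, y i ∈ Ioo (0 : ℝ) 1},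
      ∀ t ∈ Ioo (0 : ℝ) 1,
      HasDerivAt
        (fun s : ℝ => A k (Fin.insertNth k ((Fin.snoc y s : Fin (d + 1) → ℝ) (Fin.last d))
          (Fin.init (Fin.snoc y s : Fin (d + 1) → ℝ))))
        (A' k (Fin.insertNth k ((Fin.snoc y t : Fin (d + 1) → ℝ) (Fin.last d))
          (Fin.init (Fin.snoc y t : Fin (d + 1) → ℝ)))) t := by
    intro k y hy t ht
    simp only [Fin.snoc_last, Fin.init_snoc]
    have hx : (Fin.insertNth k t y : Fin (d + 1) → ℝ) ∈
        {x : Fin (d + 1) → ℝ | ∀ i, x i ∈ Ioo (0 : ℝ) 1} := insertNth_mem_setOf k ht hy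
    have h := hder k _ hx
    simp only [Fin.insertNth_apply_same, update_insertNth] at h
    exact h
  -- (b) the bulk representations `R k = [(0,1)^(d+1), A' k]` and their cycled copies `Rt k`
  have hUsa : IsSemialgebraic ℚ {x : Fin (d + 1) → ℝ | ∀ i, x i ∈ Ioo (0 : ℝ) 1} :=
    KZ.isSemialgebraic_unitCube (d + 1)
  have hRex : ∀ k : Fin (d + 1), ∃ Rk : KZ.IntegralRep (d + 1),
      Rk.domain = {x : Fin (d + 1) → ℝ | ∀ i, x i ∈ Ioo (0 : ℝ) 1} ∧ Rk.integrand = A' k := fun k =>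
    ⟨⟨{x | ∀ i, x i ∈ Ioo (0 : ℝ) 1}, A' k, hUsa, hA' k, hint k⟩, rfl, rfl⟩
  choose R hRd hRi using hRex
  have hRtex : ∀ k : Fin (d + 1), ∃ Rk : KZ.IntegralRep (d + 1),
      Rk.domain = {x : Fin (d + 1) → ℝ | ∀ i, x i ∈ Ioo (0 : ℝ) 1} ∧
        Rk.integrand = fun z => A' k (Fin.insertNth k (z (Fin.last d)) (Fin.init z)) := fun k =>
    ⟨⟨{x | ∀ i, x i ∈ Ioo (0 : ℝ) 1}, fun z => A' k (Fin.insertNth k (z (Fin.last d)) (Fin.init z)),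
      hUsa, hB'sa k, hB'int k⟩, rfl, rfl⟩
  choose Rt hRtd hRti using hRtex
  -- (c) the three pieces
  have h2 : ∀ k : Fin (d + 1), KZ.of (R k) - KZ.of (Rt k) ∈ KZ.relations := fun k =>
    h₂ d k (R k) (Rt k) (hRd k) (hRtd k) fun z _ => by rw [hRti k, hRi k]
  have h1 : ∀ k : Fin (d + 1), KZ.of (Rt k) - KZ.of (rf k 1) + KZ.of (rf k 0) ∈ KZ.relations := by
    intro k
    refine h₁ d (fun z => A k (Fin.insertNth k (z (Fin.last d)) (Fin.init z)))
      (fun z => A' k (Fin.insertNth k (z (Fin.last d)) (Fin.init z))) (Rt k) (rf k 0) (rf k 1)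
      (hBsa k) (hBcont k) (hBder k) (hRtd k) (fun z _ => by rw [hRti k]) (hdom k 0) (hdom k 1)
      ?_ ?_
    · intro y hy
      rw [hface k 0 hy]
      simp
    · intro y hy
      rw [hface k 1 hy]
      simp
  have h3 : (∑ k : Fin (d + 1), ((-1 : ℤ) ^ (k : ℕ)) • KZ.of (R k)) ∈ KZ.relations := by
    refine h₃ (d + 1) (d + 1) {x : Fin (d + 1) → ℝ | ∀ i, x i ∈ Ioo (0 : ℝ) 1} R
      (fun k => (-1 : ℤ) ^ (k : ℕ)) (fun k => hRd k) fun x hx => ?_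
    have h := hclosed x hx
    simp only [hRi]
    push_cast
    exact h
  -- (d) signs in the free abelian group
  have key : ∀ k : Fin (d + 1),
      (∑ s : Fin 2, ((-1 : ℤ) ^ ((k : ℕ) + (s : ℕ))) • KZ.of (rf k s)) =
        ((-1 : ℤ) ^ (k : ℕ)) • ((KZ.of (Rt k) - KZ.of (rf k 1) + KZ.of (rf k 0)) +
          (KZ.of (R k) - KZ.of (Rt k))) - ((-1 : ℤ) ^ (k : ℕ)) • KZ.of (R k) := by
    intro k
    rw [Fin.sum_univ_two]
    simp only [Fin.val_zero, Fin.val_one]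
    module
  rw [Finset.sum_congr rfl fun k _ => key k, Finset.sum_sub_distrib]
  exact KZ.relations.sub_mem
    (KZ.relations.sum_mem fun k _ => KZ.relations.zsmul_mem (KZ.relations.add_mem (h1 k) (h2 k)) _) h3

end Summit.KontsevichZagierPeriods.CobordismMove.CubeStokesSplit
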